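import Summits.CriticalPhenomena.PercolationContinuityZ3.Theorems.PercNearOneGluingNoHeavyLowerTailSahiTwoLevelBernsteinBridge
import Summits.CriticalPhenomena.PercolationContinuityZ3.Theorems.PercNearOneGluingNoHeavyLowerTailSahiCoSunflowerTwoLevel
import Summits.CriticalPhenomena.PercolationContinuityZ3.Theorems.PercNearOneGluingNoHeavyLowerTailSahiCoSunflowerOrCoordinate
import Summits.CriticalPhenomena.PercolationContinuityZ3.Theorems.SahiMasterFamilyFInequalityFirstArgument
import Mathlib.Tactic.Linarith
import Mathlib.Tactic.Ring
import HarnessLib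

/-!
# `NoHeavyLowerTail` (crux stmt-CriticalPhenomena-4575), master-family line P1: the two-level law of the CO-SUNFLOWER class at a
# PRIVATE COORDINATE with empty bottom section — THEOREM (an exact identity and two Harris inequalities)

Support file (seat `prim-masterthm-p1`, gen 8; `--supports stmt-CriticalPhenomena-4575`).  No definition, no `sorry`, standard axioms.
Memo `run/shared/lean/prim/prim-masterthm/FROM-prim-masterthm-p1-g8-PRIVATE-COORDINATE.md`.

CONTEXT.  `…SahiCoSunflowerTwoLevel` types the census-clean conjecture `CoSunflowerTwoLevel` — the TOP two-level law `3B₂(e) ≥ B₃(e)`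
(bnk-2's `SahiTwoLevelPlus` shape) at every coordinate `e` of every increasing triple `(G₂ ∪ G₃, G₁ ∪ G₃, G₁ ∪ G₂)` — and reduces Sahi's
`C_3` on that class (= Kahn's Conjecture 5 on sunflower complements, the tree's open `(1 + a)(ab − e₂) ≥ e₃`) to it.  Gen 7's memo
(§4, "NEXT (2)(a)") isolated the smallest open instance: `e` a PRIVATE coordinate of `G₃` (`G₁, G₂` ignore `e`) with EMPTY bottom section,
`G₃ = {e ∈ ω} ∩ K` (`K` ignoring `e`), where the fibre is quadratic and the law reads `β₁ ≥ 0`; its aggregate (Harris-cell) relaxation was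
reported infeasible.  THIS FILE PROVES IT, for every product weight, by an exact identity:

* `twoLevelForm_pairUnion_eq` — for ANY three events `G₁, G₂, K` and `W = G₁ ∪ G₂`, with `m(X) = μ_p(X)`:
    `T((G₂∪K, G₁∪K, W), (G₂, G₁, W)) = m(G₁∩G₂)·[m(W ∪ K) − m(W)] + (2 − m(W))·[Cov(G₁, G₂ ∪ K) + Cov(G₂, G₁ ∪ K)]`,
  `T = twoLevelForm` (bnk-2's two-level form, `…SahiTwoLevelC3`), `Cov(X,Y) = m(X ∩ Y) − m(X)m(Y)` (a ring identity on the Venn cells);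
* `twoLevelForm_pairUnion_nonneg` — hence `T ≥ 0` for increasing `G₁, G₂, K` (Harris twice, monotonicity once): the nested pair
  `(G₂, G₁, W) ⊆ (G₂∪K, G₁∪K, W)` is a PROVED instance of `SahiTwoLevelMinus`, and — the third increment being `0` — of `SahiTwoLevelPlus`
  (`twoLevelPlus_pairUnion_nonneg`);
* **`coSunflowerTwoLevel_privateCoord`** — the body of `CoSunflowerTwoLevel` at `(G₁, G₂, {e ∈ ω} ∩ K, e)` for `G₁, G₂, K` ignoring `e`
  (`P2`'s bridge `coordPiece₂_add_eq_twoLevelPlus` turns `b₂(e) + E_3(U⁰) + E_3(U¹)` into `T − ∏δ` of the sections, which are the pair above);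
* `sahiE_three_pair_pairUnion_eq/nonneg` — `E_3(G₂, G₁, G₁ ∪ G₂) = (2 − m(W))·Cov(G₁,G₂) ≥ 0` (the bottom section);
* **`sahiE_three_pairUnion_coordMeet_nonneg`** — CLOSURE: if `E_3(G₂ ∪ K, G₁ ∪ K, G₁ ∪ G₂) ≥ 0` then
  `E_3(G₂ ∪ ({e∈ω} ∩ K), G₁ ∪ ({e∈ω} ∩ K), G₁ ∪ G₂) ≥ 0` (weak local step of `…SahiCoSunflowerTwoLevel`): the set of co-sunflower triples
  satisfying Sahi's `C_3` is closed under AND-ing a fresh private coordinate into `G₃`; e.g. with gen 7's `…OrCoordinate` /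
  Sahi's cylinder members this settles `G₃ = {e ∈ ω} ∩ {e' ∈ ω}`-type generators glued onto any solved `K`.
In the reflected (sunflower-complement) picture the identity is `2β₁ = c·μ(F₁ᶜF₂ᶜ) + (1 + c + f₁ + f₂)·μ(F₁F₂K') − (1 + c)(f₁·μ(F₂K') + f₂·μ(F₁K'))`
(`c = μ(F₁F₂)`), bounded below by `μ(F₁ᶜF₂ᶜ)·μ(F₁F₂ ∖ K') ≥ 0`.
HONEST FRAMING: one new proved stratum of a typed conjecture; `CoSunflowerTwoLevel` at shared coordinates, the class law, and Kahn's
Conjecture 5 remain OPEN. [this work]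
-/

noncomputable section

open scoped Classical

namespace Summit.CriticalPhenomena.PercolationContinuityZ3.Theorems

namespace SahiCoSunflowerPrivate

open Finset Function
open Literature.Combinatorics.Sahi2008
open Literature.Probability.LatticeModels (sahiE3 prodBernoulli)
open Literature.Probability.Percolation.DecisionTree (ind ind_of_mem ind_of_not_mem ind_nonneg)
open SahiCoordinateBernstein (coordPiece₂)

variable {ι : Type} [Fintype ι]

local notation3 (prettyPrint := false) "m⟦" p ", " X "⟧" => ex (bernoulliWeight p) (ind X)

/-! ### 1. Venn-cell expansions of the events that occur -/

omit [Fintype ι] in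
/-- Pointwise Venn expansion: `1_{(G₂∪K)∩(G₁∪K)∩(G₁∪G₂)} = 1_{G₁G₂} + 1_{G₁K} + 1_{G₂K} − 2·1_{G₁G₂K}`. [folklore] -/
theorem ind_top3_eq (G₁ G₂ K : Set (Set ι)) :
    ind ((G₂ ∪ K) ∩ (G₁ ∪ K) ∩ (G₁ ∪ G₂)) =
      ind (G₁ ∩ G₂) + ind (G₁ ∩ K) + ind (G₂ ∩ K) - ind (G₁ ∩ G₂ ∩ K) - ind (G₁ ∩ G₂ ∩ K) := by
  funext ω
  simp only [Pi.add_apply, Pi.sub_apply]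
  by_cases h1 : ω ∈ G₁ <;> by_cases h2 : ω ∈ G₂ <;> by_cases h3 : ω ∈ K <;>
    simp [ind_of_mem, ind_of_not_mem, h1, h2, h3]

omit [Fintype ι] in
/-- `1_{(G₁∪K)∩(G₁∪G₂)} = 1_{G₁} + 1_{G₂K} − 1_{G₁G₂K}`. [folklore] -/
theorem ind_top12_eq (G₁ G₂ K : Set (Set ι)) :
    ind ((G₁ ∪ K) ∩ (G₁ ∪ G₂)) = ind G₁ + ind (G₂ ∩ K) - ind (G₁ ∩ G₂ ∩ K) := by
  funext ω
  simp only [Pi.add_apply, Pi.sub_apply]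
  by_cases h1 : ω ∈ G₁ <;> by_cases h2 : ω ∈ G₂ <;> by_cases h3 : ω ∈ K <;>
    simp [ind_of_mem, ind_of_not_mem, h1, h2, h3]

omit [Fintype ι] in
/-- `1_{(G₂∪K)∩(G₁∪G₂)} = 1_{G₂} + 1_{G₁K} − 1_{G₁G₂K}`. [folklore] -/
theorem ind_top02_eq (G₁ G₂ K : Set (Set ι)) :
    ind ((G₂ ∪ K) ∩ (G₁ ∪ G₂)) = ind G₂ + ind (G₁ ∩ K) - ind (G₁ ∩ G₂ ∩ K) := by
  funext ω
  simp only [Pi.add_apply, Pi.sub_apply]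
  by_cases h1 : ω ∈ G₁ <;> by_cases h2 : ω ∈ G₂ <;> by_cases h3 : ω ∈ K <;>
    simp [ind_of_mem, ind_of_not_mem, h1, h2, h3]

omit [Fintype ι] in
/-- `1_{(G₂∪K)∩(G₁∪K)} = 1_{G₁G₂} + 1_K − 1_{G₁G₂K}`. [folklore] -/
theorem ind_top01_eq (G₁ G₂ K : Set (Set ι)) :
    ind ((G₂ ∪ K) ∩ (G₁ ∪ K)) = ind (G₁ ∩ G₂) + ind K - ind (G₁ ∩ G₂ ∩ K) := by
  funext ω
  simp only [Pi.add_apply, Pi.sub_apply]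
  by_cases h1 : ω ∈ G₁ <;> by_cases h2 : ω ∈ G₂ <;> by_cases h3 : ω ∈ K <;>
    simp [ind_of_mem, ind_of_not_mem, h1, h2, h3]

omit [Fintype ι] in
/-- `1_{G₁∪G₂∪K} = 1_{G₁} + 1_{G₂} + 1_K − 1_{G₁G₂} − 1_{G₁K} − 1_{G₂K} + 1_{G₁G₂K}`. [folklore] -/
theorem ind_union3_eq (G₁ G₂ K : Set (Set ι)) :
    ind (G₁ ∪ G₂ ∪ K) = ind G₁ + ind G₂ + ind K - ind (G₁ ∩ G₂) - ind (G₁ ∩ K) - ind (G₂ ∩ K) + ind (G₁ ∩ G₂ ∩ K) := by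
  funext ω
  simp only [Pi.add_apply, Pi.sub_apply]
  by_cases h1 : ω ∈ G₁ <;> by_cases h2 : ω ∈ G₂ <;> by_cases h3 : ω ∈ K <;>
    simp [ind_of_mem, ind_of_not_mem, h1, h2, h3]

omit [Fintype ι] in
/-- `1_{G₁∩(G₂∪K)} = 1_{G₁G₂} + 1_{G₁K} − 1_{G₁G₂K}`. [folklore] -/
theorem ind_inter_union_eq (G₁ G₂ K : Set (Set ι)) :
    ind (G₁ ∩ (G₂ ∪ K)) = ind (G₁ ∩ G₂) + ind (G₁ ∩ K) - ind (G₁ ∩ G₂ ∩ K) := by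
  funext ω
  simp only [Pi.add_apply, Pi.sub_apply]
  by_cases h1 : ω ∈ G₁ <;> by_cases h2 : ω ∈ G₂ <;> by_cases h3 : ω ∈ K <;>
    simp [ind_of_mem, ind_of_not_mem, h1, h2, h3]

omit [Fintype ι] in
/-- `1_{G₂∩(G₁∪K)} = 1_{G₁G₂} + 1_{G₂K} − 1_{G₁G₂K}`. [folklore] -/
theorem ind_inter_union_eq' (G₁ G₂ K : Set (Set ι)) :
    ind (G₂ ∩ (G₁ ∪ K)) = ind (G₁ ∩ G₂) + ind (G₂ ∩ K) - ind (G₁ ∩ G₂ ∩ K) := by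
  funext ω
  simp only [Pi.add_apply, Pi.sub_apply]
  by_cases h1 : ω ∈ G₁ <;> by_cases h2 : ω ∈ G₂ <;> by_cases h3 : ω ∈ K <;>
    simp [ind_of_mem, ind_of_not_mem, h1, h2, h3]

/-! ### 2. The identity and the two-level laws on the pair `(G₂, G₁, W) ⊆ (G₂∪K, G₁∪K, W)` -/

/-- **THE IDENTITY.**  For any events `G₁, G₂, K` (no monotonicity needed) and `W = G₁ ∪ G₂`, bnk-2's two-level form of the nested pair
`(G₂, G₁, W) ⊆ (G₂ ∪ K, G₁ ∪ K, W)` under a product weight is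
`m(G₁G₂)·[m(W ∪ K) − m(W)] + (2 − m(W))·[(m(G₁ ∩ (G₂∪K)) − m(G₁)m(G₂∪K)) + (m(G₂ ∩ (G₁∪K)) − m(G₂)m(G₁∪K))]`. [this work] -/
theorem twoLevelForm_pairUnion_eq (p : ι → unitInterval) (G₁ G₂ K : Set (Set ι)) :
    twoLevelForm (fun X => ex (bernoulliWeight p) (ind X)) ![G₂ ∪ K, G₁ ∪ K, G₁ ∪ G₂] ![G₂, G₁, G₁ ∪ G₂] =
      m⟦p, G₁ ∩ G₂⟧ * (m⟦p, G₁ ∪ G₂ ∪ K⟧ - m⟦p, G₁ ∪ G₂⟧)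
        + (2 - m⟦p, G₁ ∪ G₂⟧) * ((m⟦p, G₁ ∩ (G₂ ∪ K)⟧ - m⟦p, G₁⟧ * m⟦p, G₂ ∪ K⟧)
            + (m⟦p, G₂ ∩ (G₁ ∪ K)⟧ - m⟦p, G₂⟧ * m⟦p, G₁ ∪ K⟧)) := by
  rw [twoLevelForm]
  simp only [Matrix.cons_val_zero, Matrix.cons_val_one, Matrix.cons_val]
  -- set algebra for the bottom triple
  have s012 : G₂ ∩ G₁ ∩ (G₁ ∪ G₂) = G₁ ∩ G₂ := by
    ext ω; constructor
    · rintro ⟨⟨h2, h1⟩, -⟩; exact ⟨h1, h2⟩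
    · rintro ⟨h1, h2⟩; exact ⟨⟨h2, h1⟩, Or.inl h1⟩
  have s12 : G₁ ∩ (G₁ ∪ G₂) = G₁ := Set.inter_eq_left.2 Set.subset_union_left
  have s02 : G₂ ∩ (G₁ ∪ G₂) = G₂ := Set.inter_eq_left.2 Set.subset_union_right
  have s01 : G₂ ∩ G₁ = G₁ ∩ G₂ := Set.inter_comm _ _
  rw [s012, s12, s02, s01]
  -- Venn expansions of all measures
  set μ := bernoulliWeight p with hμ
  have eW : ex μ (ind (G₁ ∪ G₂)) = ex μ (ind G₁) + ex μ (ind G₂) - ex μ (ind (G₁ ∩ G₂)) :=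
    SahiCoSunflowerOrCoordinate.ex_ind_union μ G₁ G₂
  have eG2K : ex μ (ind (G₂ ∪ K)) = ex μ (ind G₂) + ex μ (ind K) - ex μ (ind (G₂ ∩ K)) :=
    SahiCoSunflowerOrCoordinate.ex_ind_union μ G₂ K
  have eG1K : ex μ (ind (G₁ ∪ K)) = ex μ (ind G₁) + ex μ (ind K) - ex μ (ind (G₁ ∩ K)) :=
    SahiCoSunflowerOrCoordinate.ex_ind_union μ G₁ K
  have e3 : ex μ (ind ((G₂ ∪ K) ∩ (G₁ ∪ K) ∩ (G₁ ∪ G₂))) = ex μ (ind (G₁ ∩ G₂)) + ex μ (ind (G₁ ∩ K)) + ex μ (ind (G₂ ∩ K))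
      - ex μ (ind (G₁ ∩ G₂ ∩ K)) - ex μ (ind (G₁ ∩ G₂ ∩ K)) := by
    rw [ind_top3_eq]; simp only [ex_add, SahiCombDisjunct.ex_sub']
  have e12 : ex μ (ind ((G₁ ∪ K) ∩ (G₁ ∪ G₂))) = ex μ (ind G₁) + ex μ (ind (G₂ ∩ K)) - ex μ (ind (G₁ ∩ G₂ ∩ K)) := by
    rw [ind_top12_eq]; simp only [ex_add, SahiCombDisjunct.ex_sub']
  have e02 : ex μ (ind ((G₂ ∪ K) ∩ (G₁ ∪ G₂))) = ex μ (ind G₂) + ex μ (ind (G₁ ∩ K)) - ex μ (ind (G₁ ∩ G₂ ∩ K)) := by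
    rw [ind_top02_eq]; simp only [ex_add, SahiCombDisjunct.ex_sub']
  have e01 : ex μ (ind ((G₂ ∪ K) ∩ (G₁ ∪ K))) = ex μ (ind (G₁ ∩ G₂)) + ex μ (ind K) - ex μ (ind (G₁ ∩ G₂ ∩ K)) := by
    rw [ind_top01_eq]; simp only [ex_add, SahiCombDisjunct.ex_sub']
  have eU3 : ex μ (ind (G₁ ∪ G₂ ∪ K)) = ex μ (ind G₁) + ex μ (ind G₂) + ex μ (ind K) - ex μ (ind (G₁ ∩ G₂))
      - ex μ (ind (G₁ ∩ K)) - ex μ (ind (G₂ ∩ K)) + ex μ (ind (G₁ ∩ G₂ ∩ K)) := by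
    rw [ind_union3_eq]; simp only [ex_add, SahiCombDisjunct.ex_sub']
  have eI1 : ex μ (ind (G₁ ∩ (G₂ ∪ K))) = ex μ (ind (G₁ ∩ G₂)) + ex μ (ind (G₁ ∩ K)) - ex μ (ind (G₁ ∩ G₂ ∩ K)) := by
    rw [ind_inter_union_eq]; simp only [ex_add, SahiCombDisjunct.ex_sub']
  have eI2 : ex μ (ind (G₂ ∩ (G₁ ∪ K))) = ex μ (ind (G₁ ∩ G₂)) + ex μ (ind (G₂ ∩ K)) - ex μ (ind (G₁ ∩ G₂ ∩ K)) := by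
    rw [ind_inter_union_eq']; simp only [ex_add, SahiCombDisjunct.ex_sub']
  rw [e3, e12, e02, e01, eU3, eI1, eI2, eW, eG2K, eG1K]
  ring

/-- **The nested pair `(G₂, G₁, G₁∪G₂) ⊆ (G₂∪K, G₁∪K, G₁∪G₂)` satisfies bnk-2's BOTTOM two-level law `SahiTwoLevelMinus`** (`T ≥ 0`), for all
increasing `G₁, G₂, K` and every product weight: the identity, Harris for `(G₁, G₂ ∪ K)` and `(G₂, G₁ ∪ K)`, and `m(W) ≤ m(W ∪ K)`.
[this work] -/
theorem twoLevelForm_pairUnion_nonneg (p : ι → unitInterval) {G₁ G₂ K : Set (Set ι)} (h₁ : IsUpperSet G₁) (h₂ : IsUpperSet G₂)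
    (hK : IsUpperSet K) :
    0 ≤ twoLevelForm (fun X => ex (bernoulliWeight p) (ind X)) ![G₂ ∪ K, G₁ ∪ K, G₁ ∪ G₂] ![G₂, G₁, G₁ ∪ G₂] := by
  rw [twoLevelForm_pairUnion_eq]
  have hH1 : m⟦p, G₁⟧ * m⟦p, G₂ ∪ K⟧ ≤ m⟦p, G₁ ∩ (G₂ ∪ K)⟧ := harris_ex_ind p h₁ (h₂.union hK)
  have hH2 : m⟦p, G₂⟧ * m⟦p, G₁ ∪ K⟧ ≤ m⟦p, G₂ ∩ (G₁ ∪ K)⟧ := harris_ex_ind p h₂ (h₁.union hK)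
  have hmono : m⟦p, G₁ ∪ G₂⟧ ≤ m⟦p, G₁ ∪ G₂ ∪ K⟧ := Pointwise.ex_ind_le_of_subset p Set.subset_union_left
  have hW1 : m⟦p, G₁ ∪ G₂⟧ ≤ 1 := ex_bernoulliWeight_ind_le_one p _
  have hm : 0 ≤ m⟦p, G₁ ∩ G₂⟧ := ex_ind_nonneg' p _
  have hA : 0 ≤ m⟦p, G₁ ∩ G₂⟧ * (m⟦p, G₁ ∪ G₂ ∪ K⟧ - m⟦p, G₁ ∪ G₂⟧) := mul_nonneg hm (sub_nonneg.2 hmono)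
  have hB : 0 ≤ (2 - m⟦p, G₁ ∪ G₂⟧) * ((m⟦p, G₁ ∩ (G₂ ∪ K)⟧ - m⟦p, G₁⟧ * m⟦p, G₂ ∪ K⟧)
      + (m⟦p, G₂ ∩ (G₁ ∪ K)⟧ - m⟦p, G₂⟧ * m⟦p, G₁ ∪ K⟧)) :=
    mul_nonneg (by linarith) (add_nonneg (sub_nonneg.2 hH1) (sub_nonneg.2 hH2))
  exact add_nonneg hA hB

/-- **… and the TOP law `SahiTwoLevelPlus`** (`T − ∏_i δ_i ≥ 0`): the third member `G₁ ∪ G₂` is the same on both levels, so the product of the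
three increments vanishes. [this work] -/
theorem twoLevelPlus_pairUnion_nonneg (p : ι → unitInterval) {G₁ G₂ K : Set (Set ι)} (h₁ : IsUpperSet G₁) (h₂ : IsUpperSet G₂)
    (hK : IsUpperSet K) :
    0 ≤ twoLevelForm (fun X => ex (bernoulliWeight p) (ind X)) ![G₂ ∪ K, G₁ ∪ K, G₁ ∪ G₂] ![G₂, G₁, G₁ ∪ G₂]
      - ∏ i : Fin 3, (ex (bernoulliWeight p) (ind ((![G₂ ∪ K, G₁ ∪ K, G₁ ∪ G₂] : Fin 3 → Set (Set ι)) i))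
          - ex (bernoulliWeight p) (ind ((![G₂, G₁, G₁ ∪ G₂] : Fin 3 → Set (Set ι)) i))) := by
  rw [Fin.prod_univ_three]
  simp only [Matrix.cons_val_zero, Matrix.cons_val_one, Matrix.cons_val, sub_self, mul_zero, sub_zero]
  exact twoLevelForm_pairUnion_nonneg p h₁ h₂ hK

/-! ### 3. The co-sunflower two-level law at a private coordinate with empty bottom section -/

omit [Fintype ι] in
/-- Sections of `{e ∈ ω} ∩ K` for `K` ignoring `e`: `K` on top, `∅` at the bottom. [folklore] -/
theorem secAt_coordMeet (e : ι) {K : Set (Set ι)} (hK : ∀ b, secAt e b K = K) :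
    secAt e true ({ω : Set ι | e ∈ ω} ∩ K) = K ∧ secAt e false ({ω : Set ι | e ∈ ω} ∩ K) = ∅ := by
  constructor
  · rw [secAt_inter, SahiCombDisjunct.secAt_true_coord, hK, Set.univ_inter]
  · rw [secAt_inter, SahiCombDisjunct.secAt_false_coord, Set.empty_inter]

/-- **THEOREM (`CoSunflowerTwoLevel` at a private coordinate with empty bottom section).**  For every finite cube, product weight `p`,
coordinate `e`, and increasing `G₁, G₂, K` that ignore `e`, the co-sunflower triple `U = (G₂ ∪ G₃, G₁ ∪ G₃, G₁ ∪ G₂)` with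
`G₃ = {e ∈ ω} ∩ K` satisfies the TOP two-level law at `e`:  `0 ≤ b₂(e) + E_3(U^{e←0}) + E_3(U^{e←1})`  (`3B₂(e) ≥ B₃(e)`; this is literally
the body of `SahiCoSunflowerTwoLevel.CoSunflowerTwoLevel` at `(G₁, G₂, G₃, e)`).  Proof: P2's bridge `coordPiece₂_add_eq_twoLevelPlus`, the
sections `U¹ = (G₂∪K, G₁∪K, G₁∪G₂)`, `U⁰ = (G₂, G₁, G₁∪G₂)`, and `twoLevelPlus_pairUnion_nonneg`. [this work] -/
theorem coSunflowerTwoLevel_privateCoord (p : ι → unitInterval) (e : ι) {G₁ G₂ K : Set (Set ι)} (h₁ : IsUpperSet G₁)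
    (h₂ : IsUpperSet G₂) (hK : IsUpperSet K) (h₁e : ∀ b, secAt e b G₁ = G₁) (h₂e : ∀ b, secAt e b G₂ = G₂)
    (hKe : ∀ b, secAt e b K = K) :
    0 ≤ coordPiece₂ p e ![G₂ ∪ ({ω : Set ι | e ∈ ω} ∩ K), G₁ ∪ ({ω : Set ι | e ∈ ω} ∩ K), G₁ ∪ G₂]
      + sahiE (bernoulliWeight p) 3
          ![ind (secAt e false (G₂ ∪ ({ω : Set ι | e ∈ ω} ∩ K))), ind (secAt e false (G₁ ∪ ({ω : Set ι | e ∈ ω} ∩ K))),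
            ind (secAt e false (G₁ ∪ G₂))]
      + sahiE (bernoulliWeight p) 3
          ![ind (secAt e true (G₂ ∪ ({ω : Set ι | e ∈ ω} ∩ K))), ind (secAt e true (G₁ ∪ ({ω : Set ι | e ∈ ω} ∩ K))),
            ind (secAt e true (G₁ ∪ G₂))] := by
  obtain ⟨sT, sF⟩ := secAt_coordMeet e hKe
  rw [SahiTwoLevel.coordPiece₂_add_eq_twoLevelPlus]
  simp only [SahiCombDisjunct.secAt_union, sT, sF, h₁e, h₂e, Set.union_empty]
  exact twoLevelPlus_pairUnion_nonneg p h₁ h₂ hK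

/-! ### 4. The bottom section and the closure corollary -/

/-- `E_3(G₂, G₁, G₁ ∪ G₂) = (2 − m(G₁ ∪ G₂))·(m(G₁ ∩ G₂) − m(G₁)m(G₂))` for any two events under a product weight. [this work] -/
theorem sahiE_three_pair_pairUnion_eq (p : ι → unitInterval) (G₁ G₂ : Set (Set ι)) :
    sahiE (bernoulliWeight p) 3 ![ind G₂, ind G₁, ind (G₁ ∪ G₂)] =
      (2 - m⟦p, G₁ ∪ G₂⟧) * (m⟦p, G₁ ∩ G₂⟧ - m⟦p, G₁⟧ * m⟦p, G₂⟧) := by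
  rw [sahiE_three]
  simp only [ind_mul_ind_eq_inter]
  have s21 : G₂ ∩ G₁ = G₁ ∩ G₂ := Set.inter_comm _ _
  have s2W : G₂ ∩ (G₁ ∪ G₂) = G₂ := Set.inter_eq_left.2 Set.subset_union_right
  have s1W : G₁ ∩ (G₁ ∪ G₂) = G₁ := Set.inter_eq_left.2 Set.subset_union_left
  have s21W : G₂ ∩ G₁ ∩ (G₁ ∪ G₂) = G₁ ∩ G₂ := by rw [s21, Set.inter_assoc, s2W]
  rw [s21W, s21, s1W, s2W, SahiCoSunflowerOrCoordinate.ex_ind_union (bernoulliWeight p) G₁ G₂]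
  ring

/-- `0 ≤ E_3(G₂, G₁, G₁ ∪ G₂)` for increasing `G₁, G₂` (Harris). [this work] -/
theorem sahiE_three_pair_pairUnion_nonneg (p : ι → unitInterval) {G₁ G₂ : Set (Set ι)} (h₁ : IsUpperSet G₁) (h₂ : IsUpperSet G₂) :
    0 ≤ sahiE (bernoulliWeight p) 3 ![ind G₂, ind G₁, ind (G₁ ∪ G₂)] := by
  rw [sahiE_three_pair_pairUnion_eq]
  exact mul_nonneg (by linarith [ex_bernoulliWeight_ind_le_one p (G₁ ∪ G₂)]) (sub_nonneg.2 (harris_ex_ind p h₁ h₂))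

/-- **CLOSURE under AND-ing a fresh private coordinate into `G₃`.**  If the co-sunflower triple of `(G₁, G₂, K)` satisfies Sahi's `C_3`,
`0 ≤ E_3(μ_p; G₂ ∪ K, G₁ ∪ K, G₁ ∪ G₂)`, and `G₁, G₂, K` ignore `e`, then so does the triple of `(G₁, G₂, {e∈ω} ∩ K)`:
`0 ≤ E_3(μ_p; G₂ ∪ ({e∈ω} ∩ K), G₁ ∪ ({e∈ω} ∩ K), G₁ ∪ G₂)` — the weak local step at `e` (`…SahiCoSunflowerTwoLevel`) with
`coSunflowerTwoLevel_privateCoord`, the bottom section `sahiE_three_pair_pairUnion_nonneg` and the hypothesis as the top section. [this work] -/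
theorem sahiE_three_pairUnion_coordMeet_nonneg (p : ι → unitInterval) (e : ι) {G₁ G₂ K : Set (Set ι)} (h₁ : IsUpperSet G₁)
    (h₂ : IsUpperSet G₂) (hK : IsUpperSet K) (h₁e : ∀ b, secAt e b G₁ = G₁) (h₂e : ∀ b, secAt e b G₂ = G₂)
    (hKe : ∀ b, secAt e b K = K) (htop : 0 ≤ sahiE (bernoulliWeight p) 3 ![ind (G₂ ∪ K), ind (G₁ ∪ K), ind (G₁ ∪ G₂)]) :
    0 ≤ sahiE (bernoulliWeight p) 3
      ![ind (G₂ ∪ ({ω : Set ι | e ∈ ω} ∩ K)), ind (G₁ ∪ ({ω : Set ι | e ∈ ω} ∩ K)), ind (G₁ ∪ G₂)] := by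
  have hO : IsUpperSet ({ω : Set ι | e ∈ ω} ∩ K) := (Pointwise.isUpperSet_coordEvent e).inter hK
  obtain ⟨sT, sF⟩ := secAt_coordMeet e hKe
  have hW := coSunflowerTwoLevel_privateCoord p e h₁ h₂ hK h₁e h₂e hKe
  have h0 : 0 ≤ sahiE (bernoulliWeight p) 3
      ![ind (secAt e false (G₂ ∪ ({ω : Set ι | e ∈ ω} ∩ K))), ind (secAt e false (G₁ ∪ ({ω : Set ι | e ∈ ω} ∩ K))),
        ind (secAt e false (G₁ ∪ G₂))] := by
    simp only [SahiCombDisjunct.secAt_union, sF, h₁e, h₂e, Set.union_empty]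
    exact sahiE_three_pair_pairUnion_nonneg p h₁ h₂
  have h1 : 0 ≤ sahiE (bernoulliWeight p) 3
      ![ind (secAt e true (G₂ ∪ ({ω : Set ι | e ∈ ω} ∩ K))), ind (secAt e true (G₁ ∪ ({ω : Set ι | e ∈ ω} ∩ K))),
        ind (secAt e true (G₁ ∪ G₂))] := by
    simp only [SahiCombDisjunct.secAt_union, sT, h₁e, h₂e]
    exact htop
  exact SahiCoSunflowerTwoLevel.sahiE_three_nonneg_of_weakTwoLevelAt p e (h₂.union hO) (h₁.union hO) (h₁.union h₂) hW h0 h1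


/-! ### 5. (gen 8, second instalment) The private coordinate with FULL TOP section: `G₃ = {e ∈ ω} ∪ H` -/

/-- **Identity for the full-top pair.**  For any events `G₁, G₂, H`, `W = G₁ ∪ G₂`, the two-level form of the nested pair
`(G₂ ∪ H, G₁ ∪ H, W) ⊆ (univ, univ, W)` under a product weight is the single covariance `m(W ∩ (G₁G₂ ∪ H)) − m(W)·m(G₁G₂ ∪ H)`. [this work] -/
theorem twoLevelForm_pairUnion_top_eq (p : ι → unitInterval) (G₁ G₂ H : Set (Set ι)) :
    twoLevelForm (fun X => ex (bernoulliWeight p) (ind X)) ![(Set.univ : Set (Set ι)), Set.univ, G₁ ∪ G₂] ![G₂ ∪ H, G₁ ∪ H, G₁ ∪ G₂] =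
      m⟦p, (G₁ ∪ G₂) ∩ (G₁ ∩ G₂ ∪ H)⟧ - m⟦p, G₁ ∪ G₂⟧ * m⟦p, G₁ ∩ G₂ ∪ H⟧ := by
  rw [twoLevelForm]
  simp only [Matrix.cons_val_zero, Matrix.cons_val_one, Matrix.cons_val, Set.univ_inter, Set.inter_self]
  rw [SahiCombDisjunct.ex_ind_univ]
  set μ := bernoulliWeight p with hμ
  -- Venn expansions (the bottom triple has the shape of §1's top triple with `K := H`)
  have e3 : ex μ (ind ((G₂ ∪ H) ∩ (G₁ ∪ H) ∩ (G₁ ∪ G₂))) = ex μ (ind (G₁ ∩ G₂)) + ex μ (ind (G₁ ∩ H)) + ex μ (ind (G₂ ∩ H))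
      - ex μ (ind (G₁ ∩ G₂ ∩ H)) - ex μ (ind (G₁ ∩ G₂ ∩ H)) := by
    rw [ind_top3_eq]; simp only [ex_add, SahiCombDisjunct.ex_sub']
  have e12 : ex μ (ind ((G₁ ∪ H) ∩ (G₁ ∪ G₂))) = ex μ (ind G₁) + ex μ (ind (G₂ ∩ H)) - ex μ (ind (G₁ ∩ G₂ ∩ H)) := by
    rw [ind_top12_eq]; simp only [ex_add, SahiCombDisjunct.ex_sub']
  have e02 : ex μ (ind ((G₂ ∪ H) ∩ (G₁ ∪ G₂))) = ex μ (ind G₂) + ex μ (ind (G₁ ∩ H)) - ex μ (ind (G₁ ∩ G₂ ∩ H)) := by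
    rw [ind_top02_eq]; simp only [ex_add, SahiCombDisjunct.ex_sub']
  have e01 : ex μ (ind ((G₂ ∪ H) ∩ (G₁ ∪ H))) = ex μ (ind (G₁ ∩ G₂)) + ex μ (ind H) - ex μ (ind (G₁ ∩ G₂ ∩ H)) := by
    rw [ind_top01_eq]; simp only [ex_add, SahiCombDisjunct.ex_sub']
  have eW : ex μ (ind (G₁ ∪ G₂)) = ex μ (ind G₁) + ex μ (ind G₂) - ex μ (ind (G₁ ∩ G₂)) :=
    SahiCoSunflowerOrCoordinate.ex_ind_union μ G₁ G₂
  have eG2H : ex μ (ind (G₂ ∪ H)) = ex μ (ind G₂) + ex μ (ind H) - ex μ (ind (G₂ ∩ H)) :=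
    SahiCoSunflowerOrCoordinate.ex_ind_union μ G₂ H
  have eG1H : ex μ (ind (G₁ ∪ H)) = ex μ (ind G₁) + ex μ (ind H) - ex μ (ind (G₁ ∩ H)) :=
    SahiCoSunflowerOrCoordinate.ex_ind_union μ G₁ H
  -- the two events on the right-hand side
  have sR : (G₁ ∪ G₂) ∩ (G₁ ∩ G₂ ∪ H) = (G₂ ∪ H) ∩ (G₁ ∪ H) ∩ (G₁ ∪ G₂) := Set.ext fun ω => by
    simp only [Set.mem_inter_iff, Set.mem_union]; tauto
  have sR' : G₁ ∩ G₂ ∪ H = (G₂ ∪ H) ∩ (G₁ ∪ H) := Set.ext fun ω => by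
    simp only [Set.mem_inter_iff, Set.mem_union]; tauto
  rw [sR, sR', e3, e12, e02, e01, eW, eG2H, eG1H]
  ring

/-- **`SahiTwoLevelMinus`/`Plus` on the full-top pair**: `0 ≤ T((univ, univ, W), (G₂∪H, G₁∪H, W))` for increasing `G₁, G₂, H` — one Harris inequality
(`W` and `G₁G₂ ∪ H` are increasing). [this work] -/
theorem twoLevelForm_pairUnion_top_nonneg (p : ι → unitInterval) {G₁ G₂ H : Set (Set ι)} (h₁ : IsUpperSet G₁) (h₂ : IsUpperSet G₂)
    (hH : IsUpperSet H) :
    0 ≤ twoLevelForm (fun X => ex (bernoulliWeight p) (ind X)) ![(Set.univ : Set (Set ι)), Set.univ, G₁ ∪ G₂] ![G₂ ∪ H, G₁ ∪ H, G₁ ∪ G₂] := by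
  rw [twoLevelForm_pairUnion_top_eq]
  exact sub_nonneg.2 (harris_ex_ind p (h₁.union h₂) ((h₁.inter h₂).union hH))

omit [Fintype ι] in
/-- Sections of `{e ∈ ω} ∪ H` for `H` ignoring `e`: everything on top, `H` at the bottom. [folklore] -/
theorem secAt_coordJoin (e : ι) {H : Set (Set ι)} (hH : ∀ b, secAt e b H = H) :
    secAt e true ({ω : Set ι | e ∈ ω} ∪ H) = Set.univ ∧ secAt e false ({ω : Set ι | e ∈ ω} ∪ H) = H := by
  constructor
  · rw [SahiCombDisjunct.secAt_union, SahiCombDisjunct.secAt_true_coord, Set.univ_union]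
  · rw [SahiCombDisjunct.secAt_union, SahiCombDisjunct.secAt_false_coord, hH, Set.empty_union]

/-- **THEOREM (`CoSunflowerTwoLevel` at a private coordinate with FULL TOP section).**  For increasing `G₁, G₂, H` ignoring `e` and
`G₃ = {e ∈ ω} ∪ H`, the co-sunflower triple `(G₂ ∪ G₃, G₁ ∪ G₃, G₁ ∪ G₂)` satisfies the top two-level law at `e`
(`0 ≤ b₂(e) + E_3(U⁰) + E_3(U¹)`): the sections are the full-top pair and `twoLevelForm_pairUnion_top_nonneg` applies.  (As a `C_3`-closure this
case is P3's disjunctive closure `sahiE_three_unionCoord_two`; the two-level-law form is recorded here next to the empty-bottom case of §3.  The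
general private coordinate — bottom `H`, top `K ⊇ H` — is NOT obtained by combining the two: see the memo, §3.) [this work] -/
theorem coSunflowerTwoLevel_privateCoord_top (p : ι → unitInterval) (e : ι) {G₁ G₂ H : Set (Set ι)} (h₁ : IsUpperSet G₁)
    (h₂ : IsUpperSet G₂) (hH : IsUpperSet H) (h₁e : ∀ b, secAt e b G₁ = G₁) (h₂e : ∀ b, secAt e b G₂ = G₂)
    (hHe : ∀ b, secAt e b H = H) :
    0 ≤ coordPiece₂ p e ![G₂ ∪ ({ω : Set ι | e ∈ ω} ∪ H), G₁ ∪ ({ω : Set ι | e ∈ ω} ∪ H), G₁ ∪ G₂]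
      + sahiE (bernoulliWeight p) 3
          ![ind (secAt e false (G₂ ∪ ({ω : Set ι | e ∈ ω} ∪ H))), ind (secAt e false (G₁ ∪ ({ω : Set ι | e ∈ ω} ∪ H))),
            ind (secAt e false (G₁ ∪ G₂))]
      + sahiE (bernoulliWeight p) 3
          ![ind (secAt e true (G₂ ∪ ({ω : Set ι | e ∈ ω} ∪ H))), ind (secAt e true (G₁ ∪ ({ω : Set ι | e ∈ ω} ∪ H))),
            ind (secAt e true (G₁ ∪ G₂))] := by
  obtain ⟨sT, sF⟩ := secAt_coordJoin e hHe
  rw [SahiTwoLevel.coordPiece₂_add_eq_twoLevelPlus]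
  simp only [SahiCombDisjunct.secAt_union, h₁e, h₂e]
  rw [← SahiCombDisjunct.secAt_union, ← SahiCombDisjunct.secAt_union, sT, sF, Set.union_univ, Set.union_univ, Fin.prod_univ_three]
  simp only [Matrix.cons_val_zero, Matrix.cons_val_one, Matrix.cons_val, sub_self, mul_zero, sub_zero]
  exact twoLevelForm_pairUnion_top_nonneg p h₁ h₂ hH

end SahiCoSunflowerPrivate

end Summit.CriticalPhenomena.PercolationContinuityZ3.Theorems
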